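import Summits.Ventures.LatticeQCDFlow.Scaling.MinNetworkMonotone

/-!
HONEST FRAMING: exact (Metropolis-corrected) sampling algorithms for lattice gauge theory; figures
of merit are autocorrelation/cost numbers at stated couplings and volumes; no continuum-physics
claim.

# LabelledHubDomination — CONJECTURE M IN ITS LABELLED FORM, FOR ANY SET OF DEEPENED PARTICLES: FOR THE METROPOLIS HUB CHAIN OF LABELLED PARTICLES WITH DEPTHS `ρ`
# (`P(i→j) = min{1, ρ_j/ρ_i}/K`), RAISING THE DEPTHS OF ANY SET OF PARTICLES LOWERS THE DISCOUNTED HUB OCCUPATION OF EVERY PARTICLE WHOSE DEPTH IS UNCHANGED, FROM EVERY START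
# (lean-2 GEN-38, ours)

Venture-side (OURS).  Cell `lqcd-flow` (pub-lqcd), unit `pub-lqcd-lean-2-g38`, 2026-08-30.  Chapter W (item 1 (i) at finite swap odds), file 29 — the quotable form of MEMO-gen37's Conjecture M
(memo §4: «for the Metropolis hub chain of `K+1` labelled particles with depths `ρ_i = 1/W_i`, `P(i→j) = min{1,ρ_j/ρ_i}/K`, raising the depth of one particle lowers the hub occupation of
every other particle, from every start»), in the discounted form the law uses and for any number of deepened particles at once.  The chain is reversible w.r.t. `ρ` with conductances
`ρ_iP(i,j) = min(ρ_i,ρ_j)/K` (`labelled_conductance`), so the row resolvent `r = δ_i + σrP` (`r(j) = Σ_n σⁿPⁿ(i,j)`, the discounted occupation of `j` from `i`) divided by `ρ` is a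
potential of the min-conductance network of files 24–25 with all weights one, `κ = 1−σ`, `β = σ/K`, source `δ_i` (`labelled_row_minNet`); file 25's comparison theorem gives
**`labelled_domination`**: `ρ ≤ ρ'` pointwise ⇒ `r'(j) ≤ r(j)` at every `j` with `ρ'_j = ρ_j`, for every start `i` (deepened or not) and every `σ ∈ [0,1)`.  Only the row sums of `P` are
used (the diagonal is the complement), so `K` is any positive constant.  Hypothesis-equations, no definitions.

## What is proved

* `labelled_conductance`, `labelled_row_minNet`, **`labelled_domination`**.

Reading (no numerics implied): in replica-exchange words — making any set of OTHER particles less persistent can only lower the (discounted) time a given particle spends in the hub.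
The per-horizon cumulative form of MEMO-gen37 is stronger and not claimed.  Literature grade (cell rule): OWN, elementary; nothing cited as a fact; no new bib keys.
-/

open Finset

namespace Summit.Ventures.LatticeQCDFlow.Scaling

section Labelled
variable {T : Type*} [Fintype T] [DecidableEq T]
variable {K σ : ℝ} {ρ : T → ℝ} {P : T → T → ℝ}

omit [Fintype T] [DecidableEq T] in
/-- The labelled hub chain is reversible w.r.t. the depths: `ρ_i·P(i,j) = min(ρ_i,ρ_j)/K` for `i ≠ j`. [ours] -/
theorem labelled_conductance (hK : 0 < K) (hρ : ∀ i, 0 < ρ i) (hPoff : ∀ i j, i ≠ j → P i j = min 1 (ρ j / ρ i) / K) {i j : T} (hij : i ≠ j) :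
    ρ i * P i j = min (ρ i) (ρ j) / K := by
  rw [hPoff i j hij]
  have hi := hρ i; have hj := hρ j
  rcases le_total (ρ i) (ρ j) with hle | hle
  · rw [min_eq_left ((one_le_div hi).mpr hle), min_eq_left hle]; ring
  · rw [min_eq_right ((div_le_one hi).mpr hle), min_eq_right hle]; field_simp

/-- **A row resolvent is a potential:** if `r = δ_i + σrP` then `φ = r/ρ` solves the unit-weight min-network system with `κ = 1−σ`, `β = σ/K` and source `δ_i`. [ours] -/
theorem labelled_row_minNet (hK : 0 < K) (hρ : ∀ i, 0 < ρ i) (hPoff : ∀ i j, i ≠ j → P i j = min 1 (ρ j / ρ i) / K)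
    (hPdiag : ∀ i, P i i = 1 - ∑ j ∈ univ.erase i, P i j) {i : T} {r : T → ℝ} (hr : ∀ j, r j = (if j = i then 1 else 0) + σ * ∑ k, r k * P k j)
    {L : Finset T → (T → ℝ) → (T → ℝ) → T → ℝ}
    (hL : ∀ A ρ φ v, L A ρ φ v = (1 - σ) * ((1 : ℝ) * ρ v) * φ v + σ / K * ∑ u ∈ A.erase v, (1 : ℝ) * 1 * min (ρ u) (ρ v) * (φ v - φ u)) :
    ∀ j, L univ ρ (fun k => r k / ρ k) j = if j = i then 1 else 0 := by
  intro j
  rw [hL]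
  have hρj := hρ j
  -- the edge sum in terms of the conductances `ρ_k P(k,j) = min(ρ_k,ρ_j)/K`
  have e1 : ∑ u ∈ univ.erase j, (1 : ℝ) * 1 * min (ρ u) (ρ j) * (r j / ρ j - r u / ρ u) = K * ∑ u ∈ univ.erase j, (ρ j * P j u * (r j / ρ j) - r u * P u j) := by
    rw [mul_sum]
    refine sum_congr rfl fun u hu => ?_
    have huj : u ≠ j := ne_of_mem_erase hu
    have c1 : ρ j * P j u = min (ρ j) (ρ u) / K := labelled_conductance hK hρ hPoff huj.symm
    have c2 : ρ u * P u j = min (ρ u) (ρ j) / K := labelled_conductance hK hρ hPoff huj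
    have hρu := hρ u
    rw [show r u * P u j = (ρ u * P u j) * (r u / ρ u) by field_simp, c1, c2, min_comm (ρ j) (ρ u)]
    field_simp
  -- `Σ_{u ≠ j} ρ_j P(j,u) = ρ_j (1 − P(j,j))` and `Σ_{u ≠ j} r(u)P(u,j) = Σ_u r(u)P(u,j) − r(j)P(j,j)`
  have e2 : ∑ u ∈ univ.erase j, (ρ j * P j u * (r j / ρ j) - r u * P u j) = r j * (1 - P j j) - (∑ u, r u * P u j - r j * P j j) := by
    rw [sum_sub_distrib]
    have a : ∑ u ∈ univ.erase j, ρ j * P j u * (r j / ρ j) = r j * (1 - P j j) := by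
      rw [← sum_mul, ← mul_sum, hPdiag j]; field_simp; ring
    have b : ∑ u ∈ univ.erase j, r u * P u j = ∑ u, r u * P u j - r j * P j j := by
      rw [Finset.sum_erase_eq_sub (mem_univ j)]
    rw [a, b]
  have hrj : r j - σ * ∑ u, r u * P u j = if j = i then 1 else 0 := by rw [hr j]; ring
  rw [e1, e2]
  have e3 : (1 - σ) * (1 * ρ j) * (r j / ρ j) + σ / K * (K * (r j * (1 - P j j) - (∑ u, r u * P u j - r j * P j j))) = r j - σ * ∑ u, r u * P u j := by
    field_simp
    ring
  rw [e3, hrj]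

variable {ρ' : T → ℝ} {P' : T → T → ℝ}

/-- **CONJECTURE M, LABELLED FORM (any set of deepened particles):** depths `0 < ρ ≤ ρ'`, the two Metropolis hub chains `P` (for `ρ`) and `P'` (for `ρ'`), a common start `i`, the row
resolvents `r = δ_i + σrP`, `r' = δ_i + σr'P'` (`0 ≤ σ < 1`): **`r'(j) ≤ r(j)` at every particle `j` with `ρ'_j = ρ_j`.** [ours] -/
theorem labelled_domination (hK : 0 < K) (hσ0 : 0 ≤ σ) (hσ1 : σ < 1) (hρ : ∀ i, 0 < ρ i) (hle : ∀ i, ρ i ≤ ρ' i)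
    (hPoff : ∀ i j, i ≠ j → P i j = min 1 (ρ j / ρ i) / K) (hPdiag : ∀ i, P i i = 1 - ∑ j ∈ univ.erase i, P i j)
    (hP'off : ∀ i j, i ≠ j → P' i j = min 1 (ρ' j / ρ' i) / K) (hP'diag : ∀ i, P' i i = 1 - ∑ j ∈ univ.erase i, P' i j)
    {i : T} {r r' : T → ℝ} (hr : ∀ j, r j = (if j = i then 1 else 0) + σ * ∑ k, r k * P k j) (hr' : ∀ j, r' j = (if j = i then 1 else 0) + σ * ∑ k, r' k * P' k j)
    {j : T} (hj : ρ' j = ρ j) : r' j ≤ r j := by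
  classical
  have hρ' : ∀ i, 0 < ρ' i := fun i => lt_of_lt_of_le (hρ i) (hle i)
  set L : Finset T → (T → ℝ) → (T → ℝ) → T → ℝ :=
    fun A ρ φ v => (1 - σ) * ((1 : ℝ) * ρ v) * φ v + σ / K * ∑ u ∈ A.erase v, (1 : ℝ) * 1 * min (ρ u) (ρ v) * (φ v - φ u) with hLdef
  have hL : ∀ A ρ φ v, L A ρ φ v = (1 - σ) * ((1 : ℝ) * ρ v) * φ v + σ / K * ∑ u ∈ A.erase v, (1 : ℝ) * 1 * min (ρ u) (ρ v) * (φ v - φ u) := fun _ _ _ _ => rfl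
  have hφ := labelled_row_minNet hK hρ hPoff hPdiag hr hL
  have hφ' := labelled_row_minNet hK hρ' hP'off hP'diag hr' hL
  have h1σ : 0 < 1 - σ := by linarith
  have hmono := minNet_antitone (N := fun _ => (1 : ℝ)) hL h1σ (div_nonneg hσ0 hK.le) (univ : Finset T).card univ rfl (fun _ _ => one_pos) ρ ρ'
    (fun v => if v = i then (1 : ℝ) else 0) (fun k => r k / ρ k) (fun k => r' k / ρ' k) (fun v _ => hρ v) (fun v _ => hle v)
    (fun v _ => by split_ifs <;> norm_num) (fun v _ => hφ v) (fun v _ => hφ' v) j (mem_univ j)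
  rw [hj] at hmono
  exact (div_le_div_iff_of_pos_right (hρ j)).mp hmono

end Labelled

end Summit.Ventures.LatticeQCDFlow.Scaling
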